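import Literature.AlgebraicGeometry.HodgeTheory.WeilClassesProductsOfFactors
import Literature.AlgebraicGeometry.HodgeTheory.WeilClassesFourfolds
import Literature.AlgebraicGeometry.HodgeTheory.WeilClassesSixfolds
import Literature.AlgebraicGeometry.HodgeTheory.WeilFourfoldsDiscOnePowers
import HarnessLib

/-!
# Weil classes on product loci from the named Weil-class facts (F1, F2, Markman 2023)

Family `hodge`, layer `Literature/AlgebraicGeometry/HodgeTheory`. Companion of
`WeilClassesProductsOfFactors` (the downward product step `W_K(A₁ × A₂) = W_K(A₁)·W_K(A₂)`, PROVED on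
the tree's real carriers). This file spells its consequences in the typing of the tree's named
Weil-class facts — CONDITIONAL uses, nothing here discharges a fact:

* `Markman2025_weilClasses_algebraic_abelianFourfold.weilClassesOf_fourfold_prod_surface_le` — F1
  (Weil classes on ALL abelian fourfolds of Weil type, arXiv:2502.03415, unrefereed) ⟹ the Weil plane
  of every product SIXFOLD `X × S` (fourfold of balanced Weil type `(2,2)` times a Weil-type surface,
  diagonal `K = ℚ(√-d)`) is algebraic;
* `Markman2023_weilClasses_algebraic_discOneWeilFourfold.weilClassesOf_fourfold_prod_surface_le` — the
  same over HYPERBOLIC (split, discriminant `1`) fourfolds `X` from the REFEREED theorem Markman, JEMS 25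
  (2023) Thm. 1.5 (= Thm. 13.4), p. 236 [numbered Thm. 1.3 in the pre-v4 arXiv text 1805.11574]
  (= Floccari–Fu, JMPA 2026, Thm. 1.1);
* `….weilClassesOf_fourfold_prod_fourfold_le` (F1 resp. Markman 2023 ⟹ product EIGHTFOLDS `X × Y`);
* `Markman2025_weilClasses_algebraic_hyperbolicSixfold.weilClassesOf_sixfold_prod_surface_le` — F2
  (split sixfolds, arXiv:2502.03415 Thm. 1.5.1) ⟹ product eightfolds `A⁶ × S²`.

Census remark (module docstring of `WeilClassesProductsOfFactors`): discriminants multiply and every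
class in `ℚ^×/Nm(K^×)` is the discriminant of a Weil-type SURFACE (`δ ≠ -1`: QM surfaces by a division
algebra `(-d, -δ)_ℚ ∋ K`), so these product loci — `5`-dimensional in the `9`-dimensional sixfold
moduli, `8`-dimensional in the `16`-dimensional eightfold moduli — meet EVERY component, split or
NON-split; over split fourfolds the trust base is refereed. They consist of non-generic (product)
members; the general member of a non-split component is untouched.

## References

* [Markman2025SurveySecant] E. Markman, arXiv:2509.23403 (ICM 2026 survey), Thm. 1.2, §11.5 Steps 1–2, §12.
* [Markman2025SecantWeil] E. Markman, arXiv:2502.03415, Thm. 1.5.1, Cor. 1.6.1.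
* [Markman2023GeneralizedKummers] E. Markman, JEMS 25 (2023) 231–321, Thm. 1.5 (= Thm. 13.4), p. 236
  (= Thm. 1.3 of the pre-v4 arXiv text 1805.11574).
* [Schoen1998HodgeWeilAddendum] C. Schoen, Compositio Math. 114 (1998) 329–336, §10.
* [vanGeemen1994HodgeAV] B. van Geemen, LNM 1594 (1994), 4.9–4.10, Lemma 5.2.
-/

noncomputable section

open CategoryTheory

namespace Literature.AlgebraicGeometry.HodgeTheory

open Literature.AlgebraicTopology.SingularHomology
open Literature.AlgebraicGeometry.Motives (IsSmoothProjective)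

section HodgeTheory

/-! ### Consequences in the typing of the named facts (conditional uses; nothing is discharged) -/

variable {X Y S B : Motives.AbelianVariety ℂ}

/-- **F1 ⟹ product SIXFOLDS.** Granted `Markman2025_weilClasses_algebraic_abelianFourfold` (Weil
classes algebraic on ALL abelian fourfolds of Weil type; arXiv:2502.03415, unrefereed): for every
`d ≥ 1`, every abelian fourfold `X` with `φ ≫ φ = -d` of balanced Weil type `(2,2)` and every abelian
surface `S` with `ψ ≫ ψ = -d` of type `(1,1)`, the Weil plane of the SIXFOLD `X × S` (diagonal `K`,
degree `6`) is algebraic. Since discriminants multiply and every class `δ_S ∈ ℚ^×/Nm(K^×)` occurs for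
Weil-type surfaces, `X × S` runs through `5`-dimensional loci in EVERY component (split or NON-split)
of the moduli of polarized Weil-type sixfolds (module docstring). [cite: Markman2025SurveySecant, Thm. 1.2 and §11.5 Step 2]
[cite: Schoen1998HodgeWeilAddendum, §10] -/
theorem Markman2025_weilClasses_algebraic_abelianFourfold.weilClassesOf_fourfold_prod_surface_le
    (hF : Markman2025_weilClasses_algebraic_abelianFourfold) {d : ℕ} (hd : 0 < d)
    (hX : X.dim = 2 * 2) (hS : S.dim = 2 * 1) {φ : X ⟶ X} {ψ : S ⟶ S}
    (hφ : φ ≫ φ = -(d • 𝟙 X)) (hψ : ψ ≫ ψ = -(d • 𝟙 S))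
    (hXbal : Module.finrank ℂ ↥(Module.End.eigenspace (complexBetti.map φ.hom.hom.hom 1).hom
          (Complex.I * (Real.sqrt d : ℂ)) ⊓
        hodgeOneZero (Motives.isSmoothProjective_of_dim_eq' hX)) = 2)
    (hSbal : Module.finrank ℂ ↥(Module.End.eigenspace (complexBetti.map ψ.hom.hom.hom 1).hom
          (Complex.I * (Real.sqrt d : ℂ)) ⊓
        hodgeOneZero (Motives.isSmoothProjective_of_dim_eq' hS)) = 1) :
    weilClassesOf (X.prod S)
        (Motives.AbelianVariety.prodLift (Motives.AbelianVariety.fst X S ≫ φ)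
          (Motives.AbelianVariety.snd X S ≫ ψ)) (2 + 1) d ≤
      algebraicClasses (X.prod S).X (2 + 1) :=
  weilClassesOf_prod_le_algebraicClasses two_pos hd hX hS hφ hψ
    (weilClassesOf_le_algebraicClasses_of_forall_isRationalClass two_pos hX hd hφ hXbal
      (hF d hd X φ hX (Motives.isSmoothProjective_of_dim_eq' hX) hφ))
    (weilClassesOf_le_algebraicClasses_surface hS hd hψ hSbal)

/-- **REFEREED input ⟹ product sixfolds over SPLIT fourfolds.** Granted
`Markman2023_weilClasses_algebraic_discOneWeilFourfold` (Markman, JEMS 25 (2023) Thm. 1.5 (= Thm. 13.4),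
p. 236 [pre-v4 arXiv: Thm. 1.3] = Floccari–Fu JMPA 2026 Thm. 1.1, refereed: Weil classes algebraic on
abelian fourfolds of Weil type of discriminant `1`, i.e. hyperbolic): for every hyperbolic Weil fourfold `(X, φ)` (some `K`-symmetrised
hyperplane class `d·e^*a + φ^*e^*a` hyperbolic) and every abelian surface `(S, ψ)` of type `(1,1)`,
the Weil plane of the sixfold `X × S` is algebraic. With `S` a QM surface for a division algebra
`D = (-d, b)_ℚ ∋ K` the sixfold `X × S` is of NON-split Weil type, discriminant `-b`
(module docstring): a refereed trust base {Markman 2023 Thm. 1.5 (= Thm. 13.4), Lefschetz (1,1)} for the Weil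
classes on the `5`-dimensional product loci of every non-split sixfold component.
[cite: Markman2023GeneralizedKummers, Theorem 1.5 (= Theorem 13.4), p. 236; pre-v4 arXiv text: Theorem 1.3]
[cite: Schoen1998HodgeWeilAddendum, §10] [cite: Markman2025SurveySecant, §11.5 Step 2] -/
theorem Markman2023_weilClasses_algebraic_discOneWeilFourfold.weilClassesOf_fourfold_prod_surface_le
    (hF : Markman2023_weilClasses_algebraic_discOneWeilFourfold) {d : ℕ} (hd : 0 < d)
    (hX : X.dim = 2 * 2) (hS : S.dim = 2 * 1) {φ : X ⟶ X} {ψ : S ⟶ S}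
    (hφ : φ ≫ φ = -(d • 𝟙 X)) (hψ : ψ ≫ ψ = -(d • 𝟙 S)) (e : Motives.ProjectiveEmbedding X.X)
    {a : complexBetti (Motives.projectiveSpace e.n ℂ) 2} (ha : IsRationalClass a) (ha0 : a ≠ 0)
    (hhyp : Motives.IsHyperbolicWeilType X φ 2
      ((d : ℂ) • complexBetti.map e.ι 2 a + complexBetti.map φ.hom.hom.hom 2 (complexBetti.map e.ι 2 a)))
    (hSbal : Module.finrank ℂ ↥(Module.End.eigenspace (complexBetti.map ψ.hom.hom.hom 1).hom
          (Complex.I * (Real.sqrt d : ℂ)) ⊓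
        hodgeOneZero (Motives.isSmoothProjective_of_dim_eq' hS)) = 1) :
    weilClassesOf (X.prod S)
        (Motives.AbelianVariety.prodLift (Motives.AbelianVariety.fst X S ≫ φ)
          (Motives.AbelianVariety.snd X S ≫ ψ)) (2 + 1) d ≤
      algebraicClasses (X.prod S).X (2 + 1) :=
  weilClassesOf_prod_le_algebraicClasses two_pos hd hX hS hφ hψ
    (weilClassesOf_le_algebraicClasses_of_isHyperbolicWeilType two_pos hd hX hφ e ha ha0 hhyp
      (hF d hd X φ hX (Motives.isSmoothProjective_of_dim_eq' hX) hφ e a ha ha0 hhyp))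
    (weilClassesOf_le_algebraicClasses_surface hS hd hψ hSbal)

/-- **F1 ⟹ product EIGHTFOLDS `X × Y` of two Weil-type fourfolds** (diagonal `K`, degree `8`):
`8`-dimensional loci in every component of the `16`-dimensional moduli of polarized Weil-type
eightfolds, discriminant `δ_X δ_Y`. [cite: Markman2025SurveySecant, Thm. 1.2 and §12]
[cite: Schoen1998HodgeWeilAddendum, §10] -/
theorem Markman2025_weilClasses_algebraic_abelianFourfold.weilClassesOf_fourfold_prod_fourfold_le
    (hF : Markman2025_weilClasses_algebraic_abelianFourfold) {d : ℕ} (hd : 0 < d)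
    (hX : X.dim = 2 * 2) (hY : Y.dim = 2 * 2) {φ : X ⟶ X} {χ : Y ⟶ Y}
    (hφ : φ ≫ φ = -(d • 𝟙 X)) (hχ : χ ≫ χ = -(d • 𝟙 Y))
    (hXbal : Module.finrank ℂ ↥(Module.End.eigenspace (complexBetti.map φ.hom.hom.hom 1).hom
          (Complex.I * (Real.sqrt d : ℂ)) ⊓
        hodgeOneZero (Motives.isSmoothProjective_of_dim_eq' hX)) = 2)
    (hYbal : Module.finrank ℂ ↥(Module.End.eigenspace (complexBetti.map χ.hom.hom.hom 1).hom
          (Complex.I * (Real.sqrt d : ℂ)) ⊓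
        hodgeOneZero (Motives.isSmoothProjective_of_dim_eq' hY)) = 2) :
    weilClassesOf (X.prod Y)
        (Motives.AbelianVariety.prodLift (Motives.AbelianVariety.fst X Y ≫ φ)
          (Motives.AbelianVariety.snd X Y ≫ χ)) (2 + 2) d ≤
      algebraicClasses (X.prod Y).X (2 + 2) :=
  weilClassesOf_prod_le_algebraicClasses two_pos hd hX hY hφ hχ
    (weilClassesOf_le_algebraicClasses_of_forall_isRationalClass two_pos hX hd hφ hXbal
      (hF d hd X φ hX (Motives.isSmoothProjective_of_dim_eq' hX) hφ))
    (weilClassesOf_le_algebraicClasses_of_forall_isRationalClass two_pos hY hd hχ hYbal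
      (hF d hd Y χ hY (Motives.isSmoothProjective_of_dim_eq' hY) hχ))

/-- **REFEREED input ⟹ product eightfolds of two SPLIT fourfolds** (`δ_X = δ_Y = 1`, product
split): Markman 2023 Thm. 1.5 (= Thm. 13.4) on both factors.
[cite: Markman2023GeneralizedKummers, Theorem 1.5 (= Theorem 13.4), p. 236; pre-v4 arXiv text: Theorem 1.3]
[cite: Schoen1998HodgeWeilAddendum, §10] -/
theorem Markman2023_weilClasses_algebraic_discOneWeilFourfold.weilClassesOf_fourfold_prod_fourfold_le
    (hF : Markman2023_weilClasses_algebraic_discOneWeilFourfold) {d : ℕ} (hd : 0 < d)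
    (hX : X.dim = 2 * 2) (hY : Y.dim = 2 * 2) {φ : X ⟶ X} {χ : Y ⟶ Y}
    (hφ : φ ≫ φ = -(d • 𝟙 X)) (hχ : χ ≫ χ = -(d • 𝟙 Y)) (e : Motives.ProjectiveEmbedding X.X)
    {a : complexBetti (Motives.projectiveSpace e.n ℂ) 2} (ha : IsRationalClass a) (ha0 : a ≠ 0)
    (hhypX : Motives.IsHyperbolicWeilType X φ 2
      ((d : ℂ) • complexBetti.map e.ι 2 a + complexBetti.map φ.hom.hom.hom 2 (complexBetti.map e.ι 2 a)))
    (e' : Motives.ProjectiveEmbedding Y.X) {a' : complexBetti (Motives.projectiveSpace e'.n ℂ) 2}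
    (ha' : IsRationalClass a') (ha0' : a' ≠ 0)
    (hhypY : Motives.IsHyperbolicWeilType Y χ 2
      ((d : ℂ) • complexBetti.map e'.ι 2 a' +
        complexBetti.map χ.hom.hom.hom 2 (complexBetti.map e'.ι 2 a'))) :
    weilClassesOf (X.prod Y)
        (Motives.AbelianVariety.prodLift (Motives.AbelianVariety.fst X Y ≫ φ)
          (Motives.AbelianVariety.snd X Y ≫ χ)) (2 + 2) d ≤
      algebraicClasses (X.prod Y).X (2 + 2) :=
  weilClassesOf_prod_le_algebraicClasses two_pos hd hX hY hφ hχ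
    (weilClassesOf_le_algebraicClasses_of_isHyperbolicWeilType two_pos hd hX hφ e ha ha0 hhypX
      (hF d hd X φ hX (Motives.isSmoothProjective_of_dim_eq' hX) hφ e a ha ha0 hhypX))
    (weilClassesOf_le_algebraicClasses_of_isHyperbolicWeilType two_pos hd hY hχ e' ha' ha0' hhypY
      (hF d hd Y χ hY (Motives.isSmoothProjective_of_dim_eq' hY) hχ e' a' ha' ha0' hhypY))

/-- **F2 ⟹ product EIGHTFOLDS `A × S` of a SPLIT Weil sixfold and a Weil-type surface.** Granted
`Markman2025_weilClasses_algebraic_hyperbolicSixfold` (arXiv:2502.03415 Thm. 1.5.1, unrefereed; its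
`d = 3` slice is Schoen 1998, refereed, `Schoen1998_weilClasses_algebraic_hyperbolicSixfold_three`):
for a hyperbolic Weil sixfold `(A, φ)` and a surface `(S, ψ)` of type `(1,1)`, the Weil plane of the
eightfold `A × S` is algebraic; discriminant `-δ_S`, so both split (`S ~ E × E`) and non-split (`S`
QM by a division algebra) eightfold components are met. [cite: Markman2025SecantWeil, Thm. 1.5.1]
[cite: Schoen1998HodgeWeilAddendum, §10] -/
theorem Markman2025_weilClasses_algebraic_hyperbolicSixfold.weilClassesOf_sixfold_prod_surface_le
    (hF : Markman2025_weilClasses_algebraic_hyperbolicSixfold) {d : ℕ} (hd : 0 < d)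
    (hA : B.dim = 2 * 3) (hS : S.dim = 2 * 1) {φ : B ⟶ B} {ψ : S ⟶ S}
    (hφ : φ ≫ φ = -(d • 𝟙 B)) (hψ : ψ ≫ ψ = -(d • 𝟙 S)) (e : Motives.ProjectiveEmbedding B.X)
    {a : complexBetti (Motives.projectiveSpace e.n ℂ) 2} (ha : IsRationalClass a) (ha0 : a ≠ 0)
    (hhyp : Motives.IsHyperbolicWeilType B φ 3
      ((d : ℂ) • complexBetti.map e.ι 2 a + complexBetti.map φ.hom.hom.hom 2 (complexBetti.map e.ι 2 a)))
    (hSbal : Module.finrank ℂ ↥(Module.End.eigenspace (complexBetti.map ψ.hom.hom.hom 1).hom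
          (Complex.I * (Real.sqrt d : ℂ)) ⊓
        hodgeOneZero (Motives.isSmoothProjective_of_dim_eq' hS)) = 1) :
    weilClassesOf (B.prod S)
        (Motives.AbelianVariety.prodLift (Motives.AbelianVariety.fst B S ≫ φ)
          (Motives.AbelianVariety.snd B S ≫ ψ)) (3 + 1) d ≤
      algebraicClasses (B.prod S).X (3 + 1) :=
  weilClassesOf_prod_le_algebraicClasses (by norm_num) hd hA hS hφ hψ
    (weilClassesOf_le_algebraicClasses_of_isHyperbolicWeilType (by norm_num) hd hA hφ e ha ha0 hhyp
      (hF d hd B φ hA (Motives.isSmoothProjective_of_dim_eq' hA) hφ e a ha ha0 hhyp))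
    (weilClassesOf_le_algebraicClasses_surface hS hd hψ hSbal)


end HodgeTheory

end Literature.AlgebraicGeometry.HodgeTheory

end
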